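import Summits.CriticalPhenomena.PercolationContinuityZ3.Theorems.PercNearOneGluingNoHeavyLowerTailSunflowerChainCertificateChecker
import HarnessLib
import HarnessLib.Audit

/-!
# `NoHeavyLowerTail` (crux stmt-CriticalPhenomena-4575), chain certificates — FINITE VERIFICATION III: canonical representatives of
# petal classes, table specifications, and the two transfer lemmas (`candP_of_M`, `M_of_isForced`)

Support file (seat `prim-ineq-prove-1` gen 33; `--supports stmt-CriticalPhenomena-4575`); part of the kernel replay of
`ChainCert.ThreeBlockMedianCertificate` (files …ChainCertificate ⟵ …Structure ⟵ …Duality ⟵ …Local ⟵ …Enumeration ⟵ …Checker ⟵ …Reps ⟵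
…Sound ⟵ …Final ⟵ compiled-check files ⟵ …Holds).  No `sorry`, no named facts, nothing asserted about the crux.  The whole chain elaborates as
ONE file (HOME/code-g33/lean/File6dev.lean, rc 0); these tree files are consecutive verbatim slices of it.  Memo:
run/shared/lean/prim/prim-ineq-prove-1/FINDING-CHAINCERT-prove1-g33.md §4–§7.

CONTENTS.  `repOf`, `repOf_spec/le/eq_iff/repOf_repOf` (representatives detect label equality), `repsList`, `repsList_choices`; `canonTab_spec`,
`eqvJ_of_canon_eq`, `medTab_spec`, `cellOf_congr_eqvJ`; `candP_of_M` (a transfer pair passes the candidate test), `mem_forcedP`, `M_of_isForced` (a forced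
pair is a transfer pair — validity `M_loc` transported along canonical positions by `M_congr`).
-/

namespace Summit.CriticalPhenomena.PercolationContinuityZ3.Theorems.SunflowerPartition

namespace ChainCert

open Finset

section FiniteCheck

variable {n : Fin 3 → ℕ}

/-! #### Representatives -/

/-- Entries of the cell array by natural position. [this work] -/
theorem cellsArray_getD_nat (D : LocalDatum) {k : ℕ} (hk : k < 27) : (cellsList D).toArray.getD k 1 = D.cell (decN k) := by
  rw [← cellsList_getD D hk, Array.getD_eq_getD_getElem?, List.getD_eq_getElem?_getD, List.getElem?_toArray]

/-- The canonical REPRESENTATIVE of a position: for a petal position, the least petal position `≤ k` with the same label; otherwise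
the position itself.  (Used in proofs only.) [this work] -/
def repOf {pre : Fin 3 → Fin 3 → Fin 3 → Bool} {D : LocalDatum} (hv : D.Valid pre) (k : ℕ) : ℕ :=
  if h : D.cell (decN k) = 1 then
    Nat.find (p := fun k' => k' ≤ k ∧ D.cell (decN k') = 1 ∧ D.E (decN k') (decN k) = true) ⟨k, le_rfl, h, hv.E_refl _⟩
  else k

/-- Non-petal positions represent themselves. [this work] -/
theorem repOf_of_ne {pre : Fin 3 → Fin 3 → Fin 3 → Bool} {D : LocalDatum} (hv : D.Valid pre) {k : ℕ} (h : D.cell (decN k) ≠ 1) :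
    repOf hv k = k := by
  unfold repOf; rw [dif_neg h]

/-- Specification of the representative of a petal position. [this work] -/
theorem repOf_spec {pre : Fin 3 → Fin 3 → Fin 3 → Bool} {D : LocalDatum} (hv : D.Valid pre) {k : ℕ} (h : D.cell (decN k) = 1) :
    repOf hv k ≤ k ∧ D.cell (decN (repOf hv k)) = 1 ∧ D.E (decN (repOf hv k)) (decN k) = true ∧
      ∀ n, n < repOf hv k → ¬ (n ≤ k ∧ D.cell (decN n) = 1 ∧ D.E (decN n) (decN k) = true) := by
  unfold repOf; rw [dif_pos h]
  refine ⟨(Nat.find_spec (p := fun k' => k' ≤ k ∧ D.cell (decN k') = 1 ∧ D.E (decN k') (decN k) = true)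
    ⟨k, le_rfl, h, hv.E_refl _⟩).1, (Nat.find_spec (p := fun k' => k' ≤ k ∧ D.cell (decN k') = 1 ∧
    D.E (decN k') (decN k) = true) ⟨k, le_rfl, h, hv.E_refl _⟩).2.1, (Nat.find_spec (p := fun k' => k' ≤ k ∧
    D.cell (decN k') = 1 ∧ D.E (decN k') (decN k) = true) ⟨k, le_rfl, h, hv.E_refl _⟩).2.2, fun n hn => ?_⟩
  exact Nat.find_min _ hn

/-- The representative is at most the position. [this work] -/
theorem repOf_le {pre : Fin 3 → Fin 3 → Fin 3 → Bool} {D : LocalDatum} (hv : D.Valid pre) (k : ℕ) : repOf hv k ≤ k := by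
  by_cases h : D.cell (decN k) = 1
  · exact (repOf_spec hv h).1
  · rw [repOf_of_ne hv h]

/-- **Representatives detect label equality**: two petal positions have the same representative iff they carry the same label. [this work] -/
theorem repOf_eq_iff {pre : Fin 3 → Fin 3 → Fin 3 → Bool} {D : LocalDatum} (hv : D.Valid pre) {k k' : ℕ}
    (hk : D.cell (decN k) = 1) (hk' : D.cell (decN k') = 1) :
    repOf hv k = repOf hv k' ↔ D.E (decN k) (decN k') = true := by
  obtain ⟨h1, h2, h3, h4⟩ := repOf_spec hv hk
  obtain ⟨h1', h2', h3', h4'⟩ := repOf_spec hv hk'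
  constructor
  · intro heq
    rw [heq] at h3
    exact hv.E_trans _ _ _ (hv.E_symm _ _ h3) h3'
  · intro hE
    -- both are the least element of the common class below the respective bounds
    by_contra hne
    rcases Nat.lt_or_gt_of_ne hne with hlt | hlt
    · -- repOf k < repOf k' : repOf k is a smaller candidate for k'
      apply h4' _ hlt
      refine ⟨?_, h2, hv.E_trans _ _ _ h3 hE⟩
      -- repOf k ≤ k' : otherwise k' < repOf k ≤ k would be a smaller candidate for k
      by_contra hgt
      exact h4 k' (by omega) ⟨by omega, hk', hv.E_symm _ _ hE⟩
    · apply h4 _ hlt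
      refine ⟨?_, h2', hv.E_trans _ _ _ h3' (hv.E_symm _ _ hE)⟩
      by_contra hgt
      exact h4' k (by omega) ⟨by omega, hk, hE⟩

/-- Representatives are roots. [this work] -/
theorem repOf_repOf {pre : Fin 3 → Fin 3 → Fin 3 → Bool} {D : LocalDatum} (hv : D.Valid pre) {k : ℕ} (hk : D.cell (decN k) = 1) :
    repOf hv (repOf hv k) = repOf hv k := by
  obtain ⟨-, h2, h3, -⟩ := repOf_spec hv hk
  exact (repOf_eq_iff hv h2 hk).mpr h3

/-- The representative list of a valid datum. [this work] -/
def repsList {pre : Fin 3 → Fin 3 → Fin 3 → Bool} {D : LocalDatum} (hv : D.Valid pre) : List ℕ :=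
  List.ofFn (n := 27) fun k => repOf hv k.val

/-- Entries of the representative list. [this work] -/
theorem repsList_getD {pre : Fin 3 → Fin 3 → Fin 3 → Bool} {D : LocalDatum} (hv : D.Valid pre) {k : ℕ} (hk : k < 27) :
    (repsList hv).getD k 0 = repOf hv k := by
  rw [List.getD_eq_getElem?_getD, repsList, List.getElem?_ofFn]; simp [hk]

/-- Entries of a prefix of the representative list. [this work] -/
theorem repsList_take_getD {pre : Fin 3 → Fin 3 → Fin 3 → Bool} {D : LocalDatum} (hv : D.Valid pre) {k k' : ℕ} (hk' : k' < k)
    (hk : k ≤ 27) : ((repsList hv).take k).getD k' 0 = repOf hv k' := by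
  rw [List.getD_eq_getElem?_getD, List.getElem?_take, if_pos hk', ← List.getD_eq_getElem?_getD]
  exact repsList_getD hv (by omega)

/-- Entries of the representative array. [this work] -/
theorem repsArray_getD {pre : Fin 3 → Fin 3 → Fin 3 → Bool} {D : LocalDatum} (hv : D.Valid pre) (j : J) :
    (repsList hv).toArray.getD (encN j) 0 = repOf hv (encN j) := by
  rw [← repsList_getD hv (encN_lt j), Array.getD_eq_getD_getElem?, List.getD_eq_getElem?_getD, List.getElem?_toArray]

/-- Entries of the representative array by natural position. [this work] -/
theorem repsArray_getD_nat {pre : Fin 3 → Fin 3 → Fin 3 → Bool} {D : LocalDatum} (hv : D.Valid pre) {k : ℕ} (hk : k < 27) :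
    (repsList hv).toArray.getD k 0 = repOf hv k := by
  rw [← repsList_getD hv hk, Array.getD_eq_getD_getElem?, List.getD_eq_getElem?_getD, List.getElem?_toArray]

/-- Comparable petal positions carry the same label (monotonicity). [this work] -/
theorem E_of_leJ {b : Fin 3 → Bool × Bool} {D : LocalDatum} (hv : D.Valid (patPre b)) {j j' : J} (h : leJ b j j' = true)
    (hj : D.cell j = 1) (hj' : D.cell j' = 1) : D.E j j' = true := by
  rw [cellOf_eq_one_iff] at hj hj'
  rcases hv.mono j j' ((leJ_eq_true_iff b _ _).mp h) with hE | hZ | hO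
  · exact hE
  · rw [hj.1] at hZ; exact absurd hZ (by decide)
  · rw [hj'.2] at hO; exact absurd hO (by decide)

/-- **Admissibility, representatives**: every entry of the representative list is an admissible choice given its prefix. [this work] -/
theorem repsList_choices {b : Fin 3 → Bool × Bool} {D : LocalDatum} (hv : D.Valid (patPre b)) (k : ℕ) (hk : k < (repsList hv).length) :
    (repsList hv)[k] ∈ choicesRep (compPet (leTab b) (cellsList D).toArray) (cellsList D).toArray ((repsList hv).take k) := by
  have hk27 : k < 27 := by simpa [repsList] using hk
  have hlen : (List.take k (repsList hv)).length = k := by simp [repsList]; omega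
  have hget : (repsList hv)[k] = repOf hv k := by simp only [repsList, List.getElem_ofFn]
  have hgoal : repOf hv k ∈ choicesRep (compPet (leTab b) (cellsList D).toArray) (cellsList D).toArray (List.take k (repsList hv)) := by
    unfold choicesRep
    simp only [List.size_toArray, list_toArray_getD, hlen, cellsArray_getD_nat D hk27]
    by_cases hp : D.cell (decN k) = 1
    · -- agreement with every earlier comparable petal position
      have hagree : ∀ k', k' ∈ (compPet (leTab b) (cellsList D).toArray).getD k [] →
          ((repsList hv).take k).getD k' 0 = repOf hv k := by
        intro k' hk'
        rw [compPet_getD _ _ hk27 (by rw [cellsArray_getD_nat D hk27]; exact hp), List.mem_filter, List.mem_range] at hk'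
        obtain ⟨hlt, hc⟩ := hk'
        have hk'27 : k' < 27 := by omega
        rw [decide_eq_true_eq, cellsArray_getD_nat D hk'27, leT_leTab b hk'27 hk27, leT_leTab b hk27 hk'27] at hc
        rw [repsList_take_getD hv hlt (le_of_lt hk27)]
        rcases (Bool.or_eq_true _ _).mp hc.2 with h | h
        · exact (repOf_eq_iff hv hc.1 hp).mpr (E_of_leJ hv h hc.1 hp)
        · exact (repOf_eq_iff hv hc.1 hp).mpr (hv.E_symm _ _ (E_of_leJ hv h hp hc.1))
      rw [if_neg (by simpa using hp)]
      obtain ⟨h1, h2, h3, h4⟩ := repOf_spec hv hp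
      rw [List.mem_filter]
      refine ⟨?_, ?_⟩
      · split
        · rename_i k' rest hcp
          have := hagree k' (by rw [hcp]; exact List.mem_cons_self)
          rw [this]; exact List.mem_singleton_self _
        · rcases Nat.eq_or_lt_of_le h1 with heq | hlt
          · rw [heq]; exact List.mem_cons_self
          · refine List.mem_cons_of_mem _ ?_
            rw [List.mem_filter, List.mem_range]
            refine ⟨hlt, ?_⟩
            rw [decide_eq_true_eq, cellsList_getD D (by omega), repsList_take_getD hv hlt (le_of_lt hk27)]
            exact ⟨h2, repOf_repOf hv hp⟩
      · rw [List.all_eq_true]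
        intro k' hk'
        rw [decide_eq_true_eq]
        exact hagree k' hk'
    · rw [if_pos (by simpa using hp), repOf_of_ne hv hp]; exact List.mem_singleton_self _
  exact hget ▸ hgoal

/-! ### F. Soundness of the bound: `X_loc ≤ F_loc` for a valid datum -/

/-- Specification of the canonical-position table. [this work] -/
theorem canonTab_spec (b : Fin 3 → Bool × Bool) {k : ℕ} (hk : k < 27) :
    eqvJ b (decN ((canonTab b).getD k 0)) (decN k) = true ∧ (canonTab b).getD k 0 < 27 := by
  rw [canonTab, Array.getD_eq_getD_getElem?, Array.getElem?_ofFn]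
  simp only [hk, ↓reduceDIte, Option.getD_some]
  cases hf : (List.range 27).find? (fun k' => eqvJ b (decN k') (decN k)) with
  | none => simp only [Option.getD_none]; exact ⟨eqvJ_refl b _, hk⟩
  | some m =>
    simp only [Option.getD_some]
    refine ⟨?_, List.mem_range.mp (List.mem_of_find?_eq_some hf)⟩
    have := List.find?_some hf
    simpa using this

/-- Equal canonical positions mean the same point. [this work] -/
theorem eqvJ_of_canon_eq (b : Fin 3 → Bool × Bool) {k k' : ℕ} (hk : k < 27) (hk' : k' < 27)
    (h : (canonTab b).getD k 0 = (canonTab b).getD k' 0) : eqvJ b (decN k) (decN k') = true := by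
  have h1 := (canonTab_spec b hk).1
  have h2 := (canonTab_spec b hk').1
  rw [h] at h1
  exact eqvJ_trans b (eqvJ_symm b h1) h2

/-- Specification of the median/maximum table. [this work] -/
theorem medTab_spec (b : Fin 3 → Bool × Bool) (ct : Array ℕ) {k₁ k₂ k₃ : ℕ} (h1 : k₁ < 27) (h2 : k₂ < 27) (h3 : k₃ < 27) :
    (medTab b ct).getD ((k₁ * 27 + k₂) * 27 + k₃) (0, 0) =
      (ct.getD (encN (medIdx (patPre b) (decN k₁) (decN k₂) (decN k₃))) 0,
       ct.getD (encN (joinIdx (patPre b) (decN k₁) (decN k₂) (decN k₃))) 0) := by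
  have hi : (k₁ * 27 + k₂) * 27 + k₃ < 19683 := by omega
  rw [medTab, Array.getD_eq_getD_getElem?, Array.getElem?_ofFn]
  simp only [hi, ↓reduceDIte, Option.getD_some]
  have e1 : ((k₁ * 27 + k₂) * 27 + k₃) / 729 = k₁ := by omega
  have e2 : ((k₁ * 27 + k₂) * 27 + k₃) / 27 % 27 = k₂ := by omega
  have e3 : ((k₁ * 27 + k₂) * 27 + k₃) % 27 = k₃ := by omega
  rw [e1, e2, e3]

/-- The same point has the same cell code (pattern form). [this work] -/
theorem cellOf_congr_eqvJ {b : Fin 3 → Bool × Bool} {D : LocalDatum} (hv : D.Valid (patPre b)) {j j' : J}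
    (h : eqvJ b j j' = true) : D.cell j = D.cell j' :=
  cellOf_congr hv ((eqvJ_eq_true_iff b j j').mp h)

/-- A transfer pair satisfies the candidate conditions (validity `M_Z … M_lift2`). [this work] -/
theorem candP_of_M {b : Fin 3 → Bool × Bool} {D : LocalDatum} (hv : D.Valid (patPre b)) {x y z : J} (hM : D.M x y = true) :
    candP b (cellsList D).toArray (repsList hv).toArray (mkRec x y z) = true := by
  have hZ := hv.M_Z x y hM
  have hO := hv.M_O x y hM
  have hlt := hv.M_lt x y hM
  have hl1 := hv.M_lift1 x y hM
  have hl2 := hv.M_lift2 x y hM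
  have hne := hv.M_lift1_ne x y hM
  have hc1 : ∀ e, D.cell (Function.update x e (y e)) ≠ 0 := by
    intro e h; rw [cellOf_eq_zero_iff] at h; rw [hl1 e] at h; exact absurd h (by decide)
  have hc2 : ∀ e, D.cell (Function.update y e (x e)) = 2 := fun e => (cellOf_eq_two_iff hv _).mpr (hl2 e)
  have hr : ∀ e e', e ≠ e' → D.cell (Function.update x e (y e)) = 1 → D.cell (Function.update x e' (y e')) = 1 →
      repOf hv (encN (Function.update x e (y e))) ≠ repOf hv (encN (Function.update x e' (y e'))) := by
    intro e e' hee' h1 h1' heq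
    have h1d : D.cell (decN (encN (Function.update x e (y e)))) = 1 := by rw [decN_encN]; exact h1
    have h1d' : D.cell (decN (encN (Function.update x e' (y e')))) = 1 := by rw [decN_encN]; exact h1'
    have hE := (repOf_eq_iff hv h1d h1d').mp heq
    rw [decN_encN, decN_encN] at hE
    have := hne e e' hee' ((cellOf_eq_one_iff D _).mp h1).2 ((cellOf_eq_one_iff D _).mp h1').2
    rw [this] at hE; exact absurd hE (by decide)
  have hx0 : D.cell x = 0 := (cellOf_eq_zero_iff D x).mpr hZ
  have hy2 : D.cell y = 2 := (cellOf_eq_two_iff hv y).mpr hO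
  have h01 := hr 0 1 (by decide); have h02 := hr 0 2 (by decide); have h12 := hr 1 2 (by decide)
  have hl0 := hlt 0; have hl1' := hlt 1; have hl2' := hlt 2
  simp only [candP, preCand, repCand, mkRec, cellsArray_getD, repsArray_getD]
  simp [hx0, hy2, hc1, hc2, hl0, hl1', hl2']
  tauto

/-- Membership in the forced list, unpacked. [this work] -/
theorem mem_forcedP {mt : Array (ℕ × ℕ)} {ca : Array (Fin 3)} {ra : Array ℕ} {p : ℕ × ℕ} (hp : p ∈ forcedP mt ca ra (petOf ca)) :
    ∃ k₁ k₂ k₃, (k₁ < 27 ∧ ca.getD k₁ 1 = 1) ∧ (k₂ < 27 ∧ ca.getD k₂ 1 = 1) ∧ (k₃ < 27 ∧ ca.getD k₃ 1 = 1) ∧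
      (ra.getD k₁ 0 ≠ ra.getD k₂ 0 ∧ ra.getD k₁ 0 ≠ ra.getD k₃ 0 ∧ ra.getD k₂ 0 ≠ ra.getD k₃ 0 ∧
        ca.getD (mt.getD ((k₁ * 27 + k₂) * 27 + k₃) (0, 0)).1 1 = 0) ∧
      p = mt.getD ((k₁ * 27 + k₂) * 27 + k₃) (0, 0) := by
  unfold forcedP petOf at hp
  split at hp
  · simp at hp
  · rw [List.mem_flatMap] at hp
    obtain ⟨k₁, hk₁, hp⟩ := hp
    rw [List.mem_flatMap] at hp
    obtain ⟨k₂, hk₂, hp⟩ := hp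
    rw [List.mem_filter, List.mem_range, decide_eq_true_eq] at hk₁ hk₂
    split at hp
    · rename_i h12
      rw [List.mem_flatMap] at hp
      obtain ⟨k₃, hk₃, hp⟩ := hp
      rw [List.mem_filter, List.mem_range, decide_eq_true_eq] at hk₃
      split at hp
      · rename_i hcond
        rw [List.mem_singleton] at hp
        exact ⟨k₁, k₂, k₃, hk₁, hk₂, hk₃, ⟨h12.2, hcond.2.1, hcond.2.2.1, hcond.2.2.2⟩, hp⟩
      · simp at hp
    · simp at hp

/-- A forced pair is a transfer pair (validity `M_loc` and `M_congr`). [this work] -/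
theorem M_of_isForced {b : Fin 3 → Bool × Bool} {D : LocalDatum} (hv : D.Valid (patPre b)) {x y z : J}
    (hF : isForced (canonTab b) (forcedP (medTab b (canonTab b)) (cellsList D).toArray (repsList hv).toArray (petOf (cellsList D).toArray)) (mkRec x y z) = true) :
    D.M x y = true := by
  rw [isForced, List.any_eq_true] at hF
  obtain ⟨⟨p₁, p₂⟩, hp, hpx⟩ := hF
  simp only [mkRec, Bool.and_eq_true, beq_iff_eq] at hpx
  obtain ⟨k₁, k₂, k₃, hk₁, hk₂, hk₃, ⟨hr12, hr13, hr23, hmed0⟩, hp⟩ := mem_forcedP hp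
  rw [medTab_spec b (canonTab b) hk₁.1 hk₂.1 hk₃.1] at hp hmed0
  dsimp only at hmed0
  rw [Prod.mk.injEq] at hp
  -- the three petal index vectors
  have hp1 : D.cell (decN k₁) = 1 := by rw [← cellsArray_getD_nat D hk₁.1]; exact hk₁.2
  have hp2 : D.cell (decN k₂) = 1 := by rw [← cellsArray_getD_nat D hk₂.1]; exact hk₂.2
  have hp3 : D.cell (decN k₃) = 1 := by rw [← cellsArray_getD_nat D hk₃.1]; exact hk₃.2
  rw [repsArray_getD_nat hv hk₁.1] at hr12 hr13
  rw [repsArray_getD_nat hv hk₂.1] at hr12 hr23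
  rw [repsArray_getD_nat hv hk₃.1] at hr13 hr23
  have hE12 : D.E (decN k₁) (decN k₂) = false := by
    rw [Bool.eq_false_iff]; intro h; exact hr12 ((repOf_eq_iff hv hp1 hp2).mpr h)
  have hE13 : D.E (decN k₁) (decN k₃) = false := by
    rw [Bool.eq_false_iff]; intro h; exact hr13 ((repOf_eq_iff hv hp1 hp3).mpr h)
  have hE23 : D.E (decN k₂) (decN k₃) = false := by
    rw [Bool.eq_false_iff]; intro h; exact hr23 ((repOf_eq_iff hv hp2 hp3).mpr h)
  -- the median is a bottom point
  have hcm := canonTab_spec b (encN_lt (medIdx (patPre b) (decN k₁) (decN k₂) (decN k₃)))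
  rw [cellsArray_getD_nat D hcm.2] at hmed0
  have hZmd : D.Z (medIdx (patPre b) (decN k₁) (decN k₂) (decN k₃)) = true := by
    rw [← cellOf_eq_zero_iff, ← hmed0]
    apply cellOf_congr_eqvJ hv
    have h := eqvJ_symm b hcm.1
    rw [decN_encN] at h
    exact h
  have hMloc := hv.M_loc (decN k₁) (decN k₂) (decN k₃) ((cellOf_eq_one_iff D _).mp hp1).1 ((cellOf_eq_one_iff D _).mp hp1).2
    ((cellOf_eq_one_iff D _).mp hp2).1 ((cellOf_eq_one_iff D _).mp hp2).2 ((cellOf_eq_one_iff D _).mp hp3).1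
    ((cellOf_eq_one_iff D _).mp hp3).2 hE12 hE13 hE23 hZmd
  -- transport along the canonical positions
  have hx : eqvJ b x (medIdx (patPre b) (decN k₁) (decN k₂) (decN k₃)) = true := by
    have := eqvJ_of_canon_eq b (encN_lt x) (encN_lt (medIdx (patPre b) (decN k₁) (decN k₂) (decN k₃)))
      (hpx.1.symm.trans hp.1)
    rwa [decN_encN, decN_encN] at this
  have hy : eqvJ b y (joinIdx (patPre b) (decN k₁) (decN k₂) (decN k₃)) = true := by
    have := eqvJ_of_canon_eq b (encN_lt y) (encN_lt (joinIdx (patPre b) (decN k₁) (decN k₂) (decN k₃)))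
      (hpx.2.symm.trans hp.2)
    rwa [decN_encN, decN_encN] at this
  have c1 := (hv.M_congr x _ ((eqvJ_eq_true_iff b _ _).mp hx) y).1
  have c2 := (hv.M_congr y _ ((eqvJ_eq_true_iff b _ _).mp hy) (medIdx (patPre b) (decN k₁) (decN k₂) (decN k₃))).2
  rw [c1, c2]; exact hMloc


end FiniteCheck

end ChainCert

end Summit.CriticalPhenomena.PercolationContinuityZ3.Theorems.SunflowerPartition
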